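import Literature.NumberTheory.GaloisCohomology.CyclicClassLocalNorm
import Literature.NumberTheory.GaloisRepresentations.LocalMuNCocycleSubgroupSplitting
import Literature.NumberTheory.GaloisRepresentations.CyclotomicTowerBrauerKilling
import Literature.NumberTheory.GaloisRepresentations.CyclicLayerSurjective
import HarnessLib

/-!
# Classes of `H²(Γ_K, μ_N)` with finite support die in a `ℤ_p`-tower with non-trivial local towers
# (Serre, *Cohomologie galoisienne* II §4.4 Prop. 13 / Lemme 1, II §3.3 Prop. 9; Tate, Cassels–Fröhlich VII §10)

Let `K` be a totally complex number field, `p` a prime, `φ : Γ_K → ℤ_p` a continuous homomorphism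
non-trivial on every decomposition group (e.g. the cyclotomic `ℤ_p`-extension,
`exists_apply_resGal_ne_one_of_isCyclotomic'`), `V_m = φ⁻¹(p^m ℤ_p)` its layers, `N ∣ p^k`, and
`c ∈ H²(Γ_K, μ_N)` a class whose localisations `loc_v c` vanish off a finite set `S` of finite places.

**Theorem** (`exists_resH_comap_span_pow_kummer_eq_zero`).  For some `m`, the Brauer class of `c`
(its image under the Kummer map `H²(μ_N) → H²(K̄ˣ)`) restricts to `0` on `V_m`:

  `res_{V_m} (Kummer c) = 0`  in `H²(V_m, K̄ˣ)`.

This is the `μ_N`-coefficient form (non-trivial Galois action on the coefficients, classes of any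
`p`-power order, support given) of the tree's `exists_nsmul_split_comap_span_pow_of_forall_ne_one`
(`CyclotomicTowerBrauerKilling.lean`: `ℚ/ℤ`-valued `p`-torsion cocycles, `μ_p ⊂ K`), with the same
proof: represent `c` by a `μ_N`-valued `2`-cocycle `e` of `Γ_K` with values in `K̄ˣ`; off `S` it
splits over `Γ_{K_v}` (hypothesis), at `v ∈ S` it splits on `res_v⁻¹(V_m)` once `N ∣ (Γ_{K_v} : res_v⁻¹(V_m))`
(`exists_cob_on_subgroup_of_pow_eq_one_of_dvd_index'`, Serre XIII §3 Prop. 7; the index is divisible by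
`p^k` for `m` large, `exists_pow_dvd_index_comap_resGal_of_ne_one`); over the fixed field `K_m` of
`V_m` the base change of `e` is locally trivial at the finite places
(`exists_cob_adicCompletion_baseChange_of_subgroup`) and at the (complex) infinite places, hence a
coboundary by the Hasse principle (`twoCocycle_cob_of_locallyTrivial`, Albert–Brauer–Hasse–Noether);
the splitting cochain is transported back from `Γ_{K_m}` to `V_m = res(Γ_{K_m})` along the
`K`-isomorphism `K̄ ≅ K̄_m` (`Algebra.IsAlgebraic.algHom_bijective₂`).

Together with `CyclicClassOfResEqZero.lean` (a class dying on a cyclic layer is `κ_N(b) ∪ ψ`) and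
`BrauerSumInvCyclicClass.lean` (`∑_v inv_v = 0` for such classes) this is the killing step of the tree's
discharge of `poitouTate_sum_localTatePairing_eq_zero`.  Theorems only; no named fact (D-0026).

## References

* J.-P. Serre, *Cohomologie galoisienne* / *Galois Cohomology* (1997), II §4.4 Prop. 13 and Lemme 1,
  II §3.3 Prop. 9. [SerreGaloisCohomology1997]
* J. W. S. Cassels, A. Fröhlich (eds.), *Algebraic Number Theory* (1967), Ch. VII (Tate) §9.6–§10.
  [CasselsFrohlichANT1967]
-/

noncomputable section

open CategoryTheory Function Field IntermediateField NumberField IsDedekindDomain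
open scoped NumberField

namespace Literature.NumberTheory.GaloisCohomology

open _root_.TopRep _root_.ContRepresentation _root_.ContinuousCohomology
open Literature.NumberTheory.GaloisRepresentations
open Literature.NumberTheory.GaloisRepresentations.DiscreteGaloisModule
open Literature.NumberTheory.GaloisRepresentations.LocalWeilDatum
open Literature.AnabelianGeometry.AbsoluteAnabelian

variable (K : Type) [Field K] [NumberField K] {p : ℕ} [hp : Fact p.Prime]

set_option maxHeartbeats 400000 in
/-- **Classes of `H²(Γ_K, μ_N)` with finite support die on a layer of a `ℤ_p`-tower with
non-trivial local towers** (`K` totally complex, `N ∣ p^k`; see the module docstring): for some `m`,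
`res_{V_m}(Kummer c) = 0` in `H²(V_m, K̄ˣ)`, `V_m = φ⁻¹(p^m ℤ_p)`.
[cite: SerreGaloisCohomology1997, II §4.4 Prop. 13 (with Lemme 1) and II §3.3 Prop. 9]
[cite: CasselsFrohlichANT1967, Ch. VII §9.6–§10] -/
theorem exists_resH_comap_span_pow_kummer_eq_zero [IsTotallyComplex K]
    (φ : absoluteGaloisGroup K →ₜ* Multiplicative ℤ_[p])
    (hφ : ∀ v : HeightOneSpectrum (𝓞 K), ∃ σ : absoluteGaloisGroup (v.adicCompletion K),
      φ (absGaloisRestrict K (v.adicCompletion K) σ) ≠ 1)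
    {N : ℕ} [NeZero N] {k : ℕ} (hN : N ∣ p ^ k) (c : galoisCohomology (mu K N) 2)
    (S : Finset (HeightOneSpectrum (𝓞 K)))
    (hS : ∀ v ∉ S, galoisCohomology.localization (mu K N) (Sum.inr v) 2 c = 0) :
    haveI : CompactSpace (absoluteGaloisGroup K) := absoluteGaloisGroup_compactSpace K
    ∃ m : ℕ, haveI : ((AddSubgroup.toSubgroup (Ideal.span {(p : ℤ_[p]) ^ m}).toAddSubgroup).comap
        φ.toMonoidHom).Normal := Subgroup.Normal.comap inferInstance _
      resH ((AddSubgroup.toSubgroup (Ideal.span {(p : ℤ_[p]) ^ m}).toAddSubgroup).comap φ.toMonoidHom)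
        (units K) 2 ((cohomologyMap (kummerι K N) 2).hom c) = 0 := by
  classical
  have hpp : p.Prime := hp.out
  haveI : CompactSpace (absoluteGaloisGroup K) := absoluteGaloisGroup_compactSpace K
  -- a `μ_N`-valued cocycle `e` representing `c`, and its Kummer image `F`
  obtain ⟨f, hf⟩ := twoCocycleClass_surjective (mu K N).toTopRep c
  set e : absoluteGaloisGroup K → absoluteGaloisGroup K → (AlgebraicClosure K)ˣ :=
    fun σ τ => muVal K N (f.1 (σ, τ)) with he_def
  have he_val : ∀ σ τ, e σ τ = muVal K N (f.1 (σ, τ)) := fun _ _ => rfl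
  have he_lc : IsLocallyConstant fun q : absoluteGaloisGroup K × absoluteGaloisGroup K => e q.1 q.2 :=
    ((IsLocallyConstant.iff_continuous f.1).2 f.1.continuous).comp (muVal K N)
  have he_coc : ∀ σ τ υ, e σ τ * e (σ * τ) υ = σ • e τ υ * e σ (τ * υ) := fun σ τ υ => by
    have h := congrArg (muVal K N) (f.2 σ τ υ)
    rw [muVal_add, muVal_add] at h
    change σ • e τ υ * e σ (τ * υ) = e (σ * τ) υ * e σ τ at h
    rw [h, mul_comm]
  have he_pow : ∀ σ τ, e σ τ ^ N = 1 := fun σ τ => muVal_pow_eq_one K N _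
  set F : contTwoCocycles (units K).toTopRep :=
    contTwoCocycles.pullback (ContinuousMonoidHom.id _) (resIdHom (kummerι K N)) f with hF_def
  have hF : ∀ σ τ, F.1 (σ, τ) = UnitsCarrier.ofUnits (e σ τ) := fun _ _ => rfl
  have hKc : (cohomologyMap (kummerι K N) 2).hom c = twoCocycleClass _ F := by
    rw [← hf]; exact cohomologyMap_twoCocycleClass (kummerι K N) f
  -- notation for the layers
  set V : ℕ → Subgroup (absoluteGaloisGroup K) := fun m =>
    (AddSubgroup.toSubgroup (Ideal.span {(p : ℤ_[p]) ^ m}).toAddSubgroup).comap φ.toMonoidHom with hV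
  have hVn : ∀ m, (V m).Normal := fun m => by rw [hV]; exact Subgroup.Normal.comap inferInstance _
  have hVo : ∀ m, IsOpen ((V m : Subgroup (absoluteGaloisGroup K)) : Set (absoluteGaloisGroup K)) :=
    fun m => isOpen_comap_span_pow φ m
  -- the local statement at a finite place `v` for the layer `m`
  let P : HeightOneSpectrum (𝓞 K) → ℕ → Prop := fun v m =>
    ∃ b : ((V m).comap ((absGaloisRestrict K (v.adicCompletion K) :
          absoluteGaloisGroup (v.adicCompletion K) →ₜ* absoluteGaloisGroup K) :
          absoluteGaloisGroup (v.adicCompletion K) →* absoluteGaloisGroup K)) →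
        (AlgebraicClosure (v.adicCompletion K))ˣ,
      IsLocallyConstant b ∧ ∀ x y : (V m).comap ((absGaloisRestrict K (v.adicCompletion K) :
          absoluteGaloisGroup (v.adicCompletion K) →ₜ* absoluteGaloisGroup K) :
          absoluteGaloisGroup (v.adicCompletion K) →* absoluteGaloisGroup K),
        Units.map (absClosureEmbedding K (v.adicCompletion K) :
            AlgebraicClosure K →* AlgebraicClosure (v.adicCompletion K))
          (e (absGaloisRestrict K (v.adicCompletion K) (x : absoluteGaloisGroup (v.adicCompletion K)))
            (absGaloisRestrict K (v.adicCompletion K) (y : absoluteGaloisGroup (v.adicCompletion K)))) =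
        b x * (x : absoluteGaloisGroup (v.adicCompletion K)) • b y / b (x * y)
  -- bad places: a layer beyond which the local statement holds
  have hP : ∀ v : HeightOneSpectrum (𝓞 K), ∃ m₀ : ℕ, ∀ m, m₀ ≤ m → P v m := by
    intro v
    haveI : CharZero (v.adicCompletion K) := charZero_adicCompletion v
    obtain ⟨m₀, hm₀⟩ := exists_pow_dvd_index_comap_resGal_of_ne_one K p φ v (hφ v) k
    refine ⟨m₀, fun m hm => ?_⟩
    obtain ⟨hlc', hcoc'⟩ := twoCocycle_baseChange K (v.adicCompletion K) e he_lc he_coc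
    have hpow' : ∀ σ τ : absoluteGaloisGroup (v.adicCompletion K),
        Units.map (absClosureEmbedding K (v.adicCompletion K) :
            AlgebraicClosure K →* AlgebraicClosure (v.adicCompletion K))
          (e (absGaloisRestrict K (v.adicCompletion K) σ) (absGaloisRestrict K (v.adicCompletion K) τ)) ^ N = 1 :=
      fun σ τ => by rw [← map_pow, he_pow, map_one]
    have hopen : IsOpen (((V m).comap ((absGaloisRestrict K (v.adicCompletion K) :
          absoluteGaloisGroup (v.adicCompletion K) →ₜ* absoluteGaloisGroup K) :
          absoluteGaloisGroup (v.adicCompletion K) →* absoluteGaloisGroup K) :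
        Subgroup (absoluteGaloisGroup (v.adicCompletion K))) : Set (absoluteGaloisGroup (v.adicCompletion K))) :=
      (hVo m).preimage (absGaloisRestrict K (v.adicCompletion K)).continuous
    exact exists_cob_on_subgroup_of_pow_eq_one_of_dvd_index' (v.adicCompletion K) _ hlc' hcoc' hpow' _
      hopen (hN.trans (hm₀ m hm))
  -- good places: the class is locally trivial, every layer works
  have hgood : ∀ v ∉ S, ∀ m, P v m := by
    intro v hv m
    haveI : CharZero (v.adicCompletion K) := charZero_adicCompletion v
    haveI : CompactSpace (absoluteGaloisGroup (v.adicCompletion K)) :=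
      absoluteGaloisGroup_compactSpace (v.adicCompletion K)
    set res := absGaloisRestrict K (v.adicCompletion K) with hres
    obtain ⟨φu, hφu⟩ := exists_unitsHom (F := K) (v.adicCompletion K)
    have h0 : Prop121vii.resMu K (v.adicCompletion K) N 2 c = 0 := by
      rw [← cohomologyMap_muLocalIso_localization, hS v hv]; exact map_zero _
    have h1 : (ContinuousCohomology.map res φu 2).hom (twoCocycleClass _ F) = 0 := by
      rw [← hKc, ← cohomologyMap_kummerι_resMu K (v.adicCompletion K) N φu hφu 2 c, h0]; exact map_zero _
    have h2 : twoCocycleClass _ (contTwoCocycles.pullback res φu F) = 0 := by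
      rw [← map_twoCocycleClass]; exact h1
    have hFv : ∀ x y : absoluteGaloisGroup (v.adicCompletion K),
        (contTwoCocycles.pullback res φu F).1 (x, y) = UnitsCarrier.ofUnits
          (Units.map (absClosureEmbedding K (v.adicCompletion K) :
            AlgebraicClosure K →* AlgebraicClosure (v.adicCompletion K)) (e (res x) (res y))) := by
      intro x y
      rw [contTwoCocycles.pullback_apply, hF, hφu]
    obtain ⟨b, hb_lc, hb⟩ := (twoCocycleClass_eq_zero_iff_exists_mul (F := v.adicCompletion K) _ _ hFv).mp h2
    exact ⟨fun x => b x, hb_lc.comp_continuous continuous_subtype_val, fun x y => hb x y⟩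
  -- a layer that works at every finite place
  obtain ⟨m, hmP⟩ : ∃ m : ℕ, ∀ v, P v m := by
    choose m₀ hm₀ using hP
    refine ⟨S.sup m₀, fun v => ?_⟩
    by_cases hvS : v ∈ S
    · exact hm₀ v _ (Finset.le_sup hvS)
    · exact hgood v hvS _
  refine ⟨m, ?_⟩
  haveI : (V m).Normal := hVn m
  -- the fixed field `K_m` of `V_m`, a number field
  obtain ⟨Km, hKmfin, hKm⟩ := exists_galFixing_eq_of_isOpen (V m) (hVo m)
  haveI : FiniteDimensional K Km := hKmfin
  haveI : CharZero Km := charZero_of_injective_algebraMap (algebraMap K Km).injective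
  haveI : NumberField Km :=
    { to_charZero := inferInstance
      to_finiteDimensional := Module.Finite.trans K Km }
  haveI : Algebra.IsAlgebraic K Km := Algebra.IsAlgebraic.of_finite K Km
  -- `res(Γ_{K_m}) = V_m`
  obtain ⟨τ, hτ⟩ := exists_range_absGaloisRestrict_eq_map_conj K Km
  have hVconj : (V m).map (MulAut.conj τ).toMonoidHom = V m := by
    ext x
    constructor
    · rintro ⟨y, hy, rfl⟩
      exact (hVn m).conj_mem y hy τ
    · intro hx
      refine ⟨τ⁻¹ * x * τ, ?_, ?_⟩
      · have := (hVn m).conj_mem x hx τ⁻¹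
        rwa [inv_inv] at this
      · change τ * (τ⁻¹ * x * τ) * τ⁻¹ = x
        group
  have hrange : ((absGaloisRestrict K Km : absoluteGaloisGroup Km →ₜ* absoluteGaloisGroup K) :
      absoluteGaloisGroup Km →* absoluteGaloisGroup K).range = V m := by
    rw [hτ, hKm, hVconj]
  have hVres : ∀ σ : absoluteGaloisGroup Km, absGaloisRestrict K Km σ ∈ V m := fun σ => by
    rw [← hrange]; exact ⟨σ, rfl⟩
  -- the base change of `e` to `Γ_{K_m}` is locally trivial everywhere
  obtain ⟨he'_lc, he'_coc⟩ := twoCocycle_baseChange K Km e he_lc he_coc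
  have hfin' := fun w' : HeightOneSpectrum (𝓞 Km) =>
    exists_cob_adicCompletion_baseChange_of_subgroup e he_lc he_coc (V m) hVres w' (hmP (w'.under (𝓞 K)))
  have hinf' : ∀ w : InfinitePlace Km,
      ∃ b : absoluteGaloisGroup w.Completion → (AlgebraicClosure w.Completion)ˣ,
        IsLocallyConstant b ∧ ∀ x y,
          Units.map (absClosureEmbedding Km w.Completion : AlgebraicClosure Km →* AlgebraicClosure w.Completion)
            (Units.map (absClosureEmbedding K Km : AlgebraicClosure K →* AlgebraicClosure Km)
              (e (absGaloisRestrict K Km (absGaloisRestrict Km w.Completion x))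
                (absGaloisRestrict K Km (absGaloisRestrict Km w.Completion y)))) =
          b x * x • b y / b (x * y) := by
    intro w
    have hcxw : w.IsComplex :=
      InfinitePlace.IsComplex.of_comap (algebraMap K Km) (IsTotallyComplex.isComplex (w.comap (algebraMap K Km)))
    haveI := subsingleton_absoluteGaloisGroup_completion_of_isComplex w hcxw
    refine ⟨fun _ => Units.map (absClosureEmbedding Km w.Completion : AlgebraicClosure Km →* AlgebraicClosure w.Completion)
        (Units.map (absClosureEmbedding K Km : AlgebraicClosure K →* AlgebraicClosure Km)
          (e (absGaloisRestrict K Km (absGaloisRestrict Km w.Completion 1))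
            (absGaloisRestrict K Km (absGaloisRestrict Km w.Completion 1)))),
      IsLocallyConstant.const _, fun x y => ?_⟩
    rw [Subsingleton.elim x 1, Subsingleton.elim y 1, one_smul, mul_one, mul_div_cancel_right]
  -- ABHN over `K_m`: `e' = ∂b'`
  obtain ⟨b', hb'_lc, hb'⟩ := twoCocycle_cob_of_locallyTrivial (K := Km)
    (fun x y => Units.map (absClosureEmbedding K Km : AlgebraicClosure K →* AlgebraicClosure Km)
      (e (absGaloisRestrict K Km x) (absGaloisRestrict K Km y))) he'_lc he'_coc hfin' hinf'
  clear hfin' hinf' he'_lc he'_coc hmP hgood hP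
  -- transport the splitting back to `V_m = res(Γ_{K_m})` along `K̄ ≅ K̄_m`
  set i : absoluteGaloisGroup Km →ₜ* absoluteGaloisGroup K := absGaloisRestrict K Km with hi_def
  set ιm : AlgebraicClosure K →ₐ[K] AlgebraicClosure Km := absClosureEmbedding K Km with hιm_def
  haveI : Algebra.IsAlgebraic K (AlgebraicClosure Km) := Algebra.IsAlgebraic.trans K Km (AlgebraicClosure Km)
  have hιbij : Function.Bijective ιm :=
    (Algebra.IsAlgebraic.algHom_bijective₂ ιm
      (IsAlgClosed.lift (R := K) (M := AlgebraicClosure K) (S := AlgebraicClosure Km))).1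
  set ιe : AlgebraicClosure K ≃ₐ[K] AlgebraicClosure Km := AlgEquiv.ofBijective ιm hιbij with hιe_def
  have hιe : ∀ x, ιe x = ιm x := fun _ => rfl
  have hιsmul : ∀ (x : absoluteGaloisGroup Km) (z : AlgebraicClosure Km),
      ιe.symm (x • z) = (i x) • ιe.symm z := fun x z => by
    apply ιe.injective
    rw [AlgEquiv.apply_symm_apply, hιe, hιm_def, hi_def, absGaloisRestrict_apply_smul, ← hιe ,
      AlgEquiv.apply_symm_apply]
  have hrinj : Function.Injective i := hi_def ▸ absGaloisRestrict_injective K Km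
  have hrange' : ((i : absoluteGaloisGroup Km →ₜ* absoluteGaloisGroup K) :
      absoluteGaloisGroup Km →* absoluteGaloisGroup K).range = V m := by rw [hi_def]; exact hrange
  let ψ₀ : absoluteGaloisGroup Km ≃ (V m) :=
    (Equiv.ofInjective i hrinj).trans (Equiv.setCongr (congrArg (fun H : Subgroup (absoluteGaloisGroup K) =>
      (H : Set (absoluteGaloisGroup K))) hrange'))
  have hψ₀ : Continuous ψ₀ := Continuous.subtype_mk i.continuous _
  haveI : CompactSpace (V m) := isCompact_iff_compactSpace.mp (Subgroup.isClosed_of_isOpen _ (hVo m)).isCompact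
  let ψ : absoluteGaloisGroup Km ≃ₜ (V m) := hψ₀.homeoOfEquivCompactToT2
  have hψ : ∀ x, ((ψ x : V m) : absoluteGaloisGroup K) = i x := fun x => rfl
  have hψsymm : ∀ s : V m, i (ψ.symm s) = s := fun s => by rw [← hψ, ψ.apply_symm_apply]
  have hψmul : ∀ s t : V m, ψ.symm (s * t) = ψ.symm s * ψ.symm t := fun s t => by
    apply hrinj
    rw [map_mul i (ψ.symm s) (ψ.symm t), hψsymm, hψsymm, hψsymm]
    rfl
  -- the transported cochain
  let B : V m → (AlgebraicClosure K)ˣ := fun s =>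
    Units.map (ιe.symm : AlgebraicClosure Km →* AlgebraicClosure K) (b' (ψ.symm s))
  have hB_lc : IsLocallyConstant B :=
    (hb'_lc.comp_continuous ψ.symm.continuous).comp _
  have hleft : ∀ u : (AlgebraicClosure K)ˣ,
      Units.map (ιe.symm : AlgebraicClosure Km →* AlgebraicClosure K)
        (Units.map (ιm : AlgebraicClosure K →* AlgebraicClosure Km) u) = u := fun u =>
    Units.ext (by
      rw [Units.coe_map, MonoidHom.coe_coe, Units.coe_map, MonoidHom.coe_coe, ← hιe]
      exact ιe.symm_apply_apply (u : AlgebraicClosure K))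
  have hsm : ∀ (x : absoluteGaloisGroup Km) (u : (AlgebraicClosure Km)ˣ),
      Units.map (ιe.symm : AlgebraicClosure Km →* AlgebraicClosure K) (x • u) =
        (i x) • Units.map (ιe.symm : AlgebraicClosure Km →* AlgebraicClosure K) u := fun x u =>
    Units.ext (by
      rw [Units.coe_map, MonoidHom.coe_coe, Units.coe_smul, Units.coe_smul, Units.coe_map, MonoidHom.coe_coe]
      exact hιsmul x u)
  have hBe : ∀ s t : V m, e s t = B s * (s : absoluteGaloisGroup K) • B t / B (s * t) := by
    intro s t
    have key := hb' (ψ.symm s) (ψ.symm t)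
    rw [← hψmul] at key
    have key' := congrArg (Units.map (ιe.symm : AlgebraicClosure Km →* AlgebraicClosure K)) key
    rw [map_div, map_mul, hsm, hψsymm, hψsymm, hleft] at key'
    exact key'
  -- conclusion: `res_{V_m} [F] = 0`
  rw [hKc, resH_twoCocycleClass, twoCocycleClass_eq_zero_iff]
  refine ⟨⟨fun s => UnitsCarrier.ofUnits (B s), ?_⟩, fun s t => ?_⟩
  · exact (hB_lc.comp UnitsCarrier.ofUnits).continuous
  · rw [contTwoCocycles.pullback_apply]
    change F.1 ((s : absoluteGaloisGroup K), (t : absoluteGaloisGroup K)) =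
      units K (s : absoluteGaloisGroup K) (UnitsCarrier.ofUnits (B t)) - UnitsCarrier.ofUnits (B (s * t)) +
        UnitsCarrier.ofUnits (B s)
    rw [hF, units_apply_ofUnits, ← ofUnits_div, ← ofUnits_mul, hBe s t]
    congr 1
    rw [mul_comm (B s) _, mul_div_right_comm]

end Literature.NumberTheory.GaloisCohomology

end
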